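import Literature.MathematicalPhysics.QuantumFieldTheory.Balaban1983to89.B1Ineq368BoxBound
import Literature.MathematicalPhysics.QuantumFieldTheory.Balaban1983to89.B1Sect1Statements

/-!
# `Balaban1983to89.B1LowerBound114Model` — T. Bałaban, *(Higgs)₂,₃ quantum fields in a finite volume. I. A lower bound*,
Commun. Math. Phys. **85** (1982) 603–626 [Balaban1982Higgs1]: the LOWER HALF of the Theorem (1.14) p. 606 — *"there exist the
constants E₋, E₊ independent of ε, T_ε and such that exp(−E₋|T_ε|) ≦ Z^ε"* — AT THE CONCRETE CUTOFF FAMILY of the lattice model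
(`B1Sect1Statements.ModelData.cutoffFamily`: one instance = one admissible lattice `P`, `Z` = the renormalized partition function
`zRen`, `vol` = `|T_ε|`), ASSEMBLED from the per-lattice end of Sect. 3 (`B1Ineq368BoxBound.lowerBound_model`: (3.26)_K → (3.66) →
(3.67) → (3.68), + (3.69) ⇒ `exp(−E₋(ε)|T_ε|) ≦ Z^ε`) and the two printed remarks that make the constant ε-INDEPENDENT — the stopping
rule p. 624 *"We take K such that L^Kε ≦ ε₀, but L^{K+1}ε > ε₀"* and p. 625 *"with a constant O(1) which in general depends on L^Kε,
thus on ε₀"* — PROVED: the only ε-dependence of `E₋(ε)` is through the box constant `C₄ = (L^Kε)^{−d}·max{0, −log(r^dω_d·r^Nω_N)}` of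
(3.68) (`B1Ineq368BoxBound.boxConst`), and `ε₀/L < L^Kε` together with a uniform lower bound `r ≧ r₀ > 0` of the radius of the
small-field set of (3.67) bound it by the ε-independent `C₄(ε₀/L, r₀) = (ε₀/L)^{−d}·max{0, −log(r₀^dω_d·r₀^Nω_N)}` (`boxConstU`).

statement-level skeleton of published theorems with citation tags; proofs where landed; nothing here is a claim about the Yang–Mills mass gap

PDF held: `paper:balaban1982-cmp85-higgs23-i` (journal page = PDF page + 602); pp. 606, 624, 625 READ AS IMAGES on the ×2 renders
`run/shared/lean/pub/pub-balaban/b2b-balaban-ref1/pages/1982-cmp85-higgs23-I/1982-cmp85-higgs23-I-p004|p022|p023-x2.png`.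

CITATION HEADER (lean-in-tree rule).  lit-balaban typed skeleton (HOME `run/shared/lean/pub/lit-balaban/`), SKELETON row **B1.Thm@606**
(owners r01/r14).  RELATION TO THE TREE (read first; nothing restated): the Theorem is typed ONCE, by r14, over the abstract carrier
`B1LowerBound.CutoffFamily` (`LowerBoundWith`, `LowerBoundPrinted`, `ThmPrinted`; p239114) and INSTANTIATED by r01 at the concrete family of
the lattice model (`B1Sect1Statements.ModelData.cutoffFamily`, `Thm114`, `LowerBound114`; p239833); r14's `B1Eq368LowerAssembly` (p252119)
assembles `LowerBoundWith F (C₁ + C₂)` for an ABSTRACT family from r12's typed (3.68)–(3.69) `B1Sect3Statements.Ineq368` with uniform `O(1)`'s;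
this seat's `B1Ineq368BoxBound.lowerBound_model` (p253232) is the end of Sect. 3 for the MODEL on ONE lattice, with the explicit
`E₋(ε) = C₁ + C₂ + C·ε₀^{κ₀}/(L^{κ₀} − 1) + C₄ + C₅ + C₆`.  WHAT THIS MODULE ADDS (and only this): the assembly AT THE CONCRETE FAMILY, one
level deeper than `B1Eq368LowerAssembly` — from the displayed analytic inputs of the induction (3.26) (`h360`: the printed step bound (3.38) with
(3.51), (3.55), (3.60)) and of the expansions pp. 624–625 ((E1) Prop. 3.1, (E2) the bound of `|V^{(K),ε}|`, (E3) `χ_K = 1` on the small-field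
set, the bounded quadratic forms, the (3.69) conjunct), stated PER LATTICE (`Inputs`) with constants chosen BEFORE the lattice (`Consts`),
to **`lowerBoundWith_cutoffFamily`**: `B1LowerBound.LowerBoundWith D.cutoffFamily E₋` with the explicit ε-independent
`E₋ = C₁ + C₂ + C·ε₀^{κ₀}/(L^{κ₀} − 1) + C₄(ε₀/L, r₀) + C₅ + C₆` (`Consts.eMinus`); hence `LowerBoundPrinted D.cutoffFamily`
(`lowerBoundPrinted_cutoffFamily`) and r01's `LowerBound114 D` (`lowerBound114_of_inputs`, using its standing hypothesis *"m² > 0"*).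
The uniformity lemmas: `mesh_gt_of_stop` (`ε₀/L < L^Kε`), `boxConst_le_boxConstU`/`boxConst_le_of_stop` (`C₄ ≦ C₄(ε₀/L, r₀)`), and, for
the PRINTED radius `r = c₁⁻¹(L^Kε)^{−(d−2)/2}p(L^Kε)` of (3.67) (`radius367` = `c₁⁻¹·B1Eq31Concrete.thrF d (L^Kε) (B2.pFn b₀ p (L^Kε))`),
`radius367_ge`: `r ≧ c₁⁻¹b₀` whenever `L^Kε ≦ ε₀ ≦ 1`, `d ≧ 2` — an admissible ε-independent `r₀`.
HONEST SCOPE: the analytic content of Props. 2.1–2.3, 3.1, 3.2, of (3.38)–(3.60) and of (3.69) is NOT proved here — it enters as the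
fields of `Inputs` (per lattice, with the uniform constants of `Consts`), i.e. exactly the hypotheses of `B1Ineq368BoxBound.lowerBound_model`;
what IS proved is the bookkeeping the print leaves to the reader between (3.68)–(3.69) and (1.14): that these inputs, with constants
independent of ε, give ONE constant `E₋` for the whole family.  `K ≦` the `K` of (1.2) is allowed (the print has equality); `L > 1`
((3.54) p. 622, `log L` in a denominator; needed for the geometric sum `Σ_j(L^jε)^{κ₀} ≦ ε₀^{κ₀}L^{κ₀}/(L^{κ₀} − 1)` of `B1Ineq367Proof`) and
*"m² > 0"* (p. 605) are hypotheses.  Unit `lit-balaban-p14` gen 7 (literature-prover-lit-balaban-p14-g7-0).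

## The print (verbatim)

p. 606 [PDF 4]: «Now the fundamental result of this paper can be formulated. **Theorem.** For the dimensions d = 2, 3 there exist
the constants E₋, E₊ independent of ε, T_ε and such that exp(−E₋|T_ε|) ≦ Z^ε ≦ exp(E₊|T_ε|). (1.14)»
p. 624 [PDF 22]: «Now we can finish the proof of the lower bound. We take K such that L^Kε ≦ ε₀, but L^{K+1}ε > ε₀, and then we have
(3.26)–(3.32) with k = K.»
p. 625 [PDF 23]: «Further we can estimate χ_K(A)χ_K(φ) ≧ Π_{x∈T^{(K)}_{L^Kε}} χ({|A(x)| ≦ c₁⁻¹(L^Kε)^{−(d−2)/2}p(L^Kε)})·χ({|φ(x)| ≦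
c₁⁻¹(L^Kε)^{−(d−2)/2}p(L^Kε)}) […]. (3.67) The quatratic forms in the exponential above are bounded, so the integral can be estimated
from below by exp(−O(1)|T_ε|) with a constant O(1) which in general depends on L^Kε, thus on ε₀. We get Z^ε ≧ Z_KZ_K(0)exp(−E₀ +
O(1)|T_ε|). (3.68) It is easily seen that Z_KZ_K(0) is almost equal exp(E₀), more exactly we have Z_KZ_K(0)exp(−E₀) = […] =
exp(O(1)|T_ε|), (3.69) and we obtain finally the required lower bound.»
-/

open _root_.MeasureTheory

namespace Literature.MathematicalPhysics.QuantumFieldTheory.Balaban1983to89.B1LowerBound114Model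

open Literature.MathematicalPhysics.QuantumFieldTheory.Balaban1983to89
open Literature.MathematicalPhysics.QuantumFieldTheory.Balaban1983to89.HiggsLattice
open Literature.MathematicalPhysics.QuantumFieldTheory.Balaban1983to89.HiggsDoubleRT
open Literature.MathematicalPhysics.QuantumFieldTheory.Balaban1983to89.B1Eq31Concrete (thrF)
open Literature.MathematicalPhysics.QuantumFieldTheory.Balaban1983to89.B1Ineq326HiggsModel (chiW extW)
open Literature.MathematicalPhysics.QuantumFieldTheory.Balaban1983to89.B1Ineq368BoxBound
open Literature.MathematicalPhysics.QuantumFieldTheory.Balaban1983to89.B1Sect1Statements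

/-! ## 1. The stopping rule `L^Kε ≦ ε₀ < L^{K+1}ε` and the uniform box constant -/

section Uniform

variable {P : Params}

/-- The stopping rule *"We take K such that L^Kε ≦ ε₀, but L^{K+1}ε > ε₀"* (p. 624) confines the last mesh to the ε-INDEPENDENT
window `ε₀/L < L^Kε (≦ ε₀)`, since `L^{K+1}ε = L·L^Kε` ((1.19) p. 607). [cite: Balaban1982Higgs1, p.624 (before (3.66)); (1.19) p.607] -/
theorem mesh_gt_of_stop {K : ℕ} {ε₀ : ℝ} (hstop : ε₀ < P.mesh (K + 1)) : ε₀ / P.L < P.mesh K := by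
  have hL : (0 : ℝ) < P.L := by exact_mod_cast P.hL
  have hmesh : P.mesh (K + 1) = P.mesh K * P.L := by
    unfold Params.mesh
    ring
  rw [div_lt_iff₀ hL, ← hmesh]
  exact hstop

/-- **The ε-independent box constant** `C₄(η, r₀) = η^{−d}·max{0, −log(r₀^dω_d·r₀^Nω_N)}` at a mesh lower bound `η` (`= ε₀/L`) and a
radius lower bound `r₀`: the constant of (3.68) *"which in general depends on L^Kε, thus on ε₀"* (p. 625), made uniform
(`B1Ineq368BoxBound.boxConst` is `C₄(L^Kε, r)`). [cite: Balaban1982Higgs1, (3.68) p.625] -/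
noncomputable def boxConstU (d N : ℕ) (η r₀ : ℝ) : ℝ :=
  (η ^ d)⁻¹ * max 0 (-Real.log ((r₀ ^ d * unitBallVol d) * (r₀ ^ N * unitBallVol N)))

/-- `C₄(η, r₀) ≧ 0` for `η ≧ 0`. [cite: Balaban1982Higgs1, (3.68) p.625] -/
theorem boxConstU_nonneg {d N : ℕ} {η : ℝ} (hη : 0 ≤ η) (r₀ : ℝ) : 0 ≤ boxConstU d N η r₀ :=
  mul_nonneg (inv_nonneg.2 (pow_nonneg hη _)) (le_max_left _ _)

/-- **Monotonicity of the box constant**: `C₄(L^Kε, r) = (L^Kε)^{−d}·max{0, −log(r^dω_d·r^Nω_N)}` decreases in the mesh and in the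
radius, so `L^Kε ≧ η > 0` and `r ≧ r₀ > 0` give `C₄(L^Kε, r) ≦ C₄(η, r₀)`. [cite: Balaban1982Higgs1, (3.68) p.625] -/
theorem boxConst_le_boxConstU {N K d : ℕ} (hd : P.d = d) {η r₀ r : ℝ} (hη : 0 < η) (hηK : η ≤ P.mesh K) (hr₀ : 0 < r₀)
    (hr : r₀ ≤ r) : boxConst P N K r ≤ boxConstU d N η r₀ := by
  subst hd
  unfold boxConst boxConstU
  have hω := unitBallVol_pos P.d
  have hωN := unitBallVol_pos N
  have hx₀ : 0 < (r₀ ^ P.d * unitBallVol P.d) * (r₀ ^ N * unitBallVol N) :=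
    mul_pos (mul_pos (pow_pos hr₀ _) hω) (mul_pos (pow_pos hr₀ _) hωN)
  have hxx : (r₀ ^ P.d * unitBallVol P.d) * (r₀ ^ N * unitBallVol N) ≤ (r ^ P.d * unitBallVol P.d) * (r ^ N * unitBallVol N) :=
    mul_le_mul (mul_le_mul_of_nonneg_right (pow_le_pow_left₀ hr₀.le hr _) hω.le)
      (mul_le_mul_of_nonneg_right (pow_le_pow_left₀ hr₀.le hr _) hωN.le) (mul_pos (pow_pos hr₀ _) hωN).le
      (mul_nonneg (pow_nonneg (hr₀.le.trans hr) _) hω.le)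
  have h1 : (P.mesh K ^ P.d)⁻¹ ≤ (η ^ P.d)⁻¹ := inv_anti₀ (pow_pos hη _) (pow_le_pow_left₀ hη.le hηK _)
  have h2 : max 0 (-Real.log ((r ^ P.d * unitBallVol P.d) * (r ^ N * unitBallVol N)))
      ≤ max 0 (-Real.log ((r₀ ^ P.d * unitBallVol P.d) * (r₀ ^ N * unitBallVol N))) :=
    max_le_max le_rfl (neg_le_neg (Real.log_le_log hx₀ hxx))
  exact mul_le_mul h1 h2 (le_max_left _ _) (inv_nonneg.2 (pow_nonneg hη.le _))

/-- **Uniform bound of the box constant from the stopping rule**: on a lattice of dimension `d`, if `L^{K+1}ε > ε₀ > 0` and the radius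
`r ≧ r₀ > 0`, then `C₄(L^Kε, r) ≦ C₄(ε₀/L, r₀)`. [cite: Balaban1982Higgs1, (3.68) p.625; p.624 (before (3.66))] -/
theorem boxConst_le_of_stop {N K d : ℕ} (hd : P.d = d) {ε₀ r₀ r : ℝ} (hε₀ : 0 < ε₀) (hstop : ε₀ < P.mesh (K + 1)) (hr₀ : 0 < r₀)
    (hr : r₀ ≤ r) : boxConst P N K r ≤ boxConstU d N (ε₀ / P.L) r₀ :=
  boxConst_le_boxConstU hd (div_pos hε₀ (by exact_mod_cast P.hL)) (mesh_gt_of_stop hstop).le hr₀ hr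

/-- The radius of the small-field set of (3.67) as printed, `r = c₁⁻¹η^{−(d−2)/2}p(η)` at `η = L^Kε`, `p(η) = b₀(1 + log η⁻¹)^p` ((3.1)
p. 613): `c₁⁻¹·B1Eq31Concrete.thrF d η (B2.pFn b₀ p η)`. [cite: Balaban1982Higgs1, (3.67) p.625; (3.1) p.613] -/
noncomputable def radius367 (d : ℕ) (c₁ b₀ p η : ℝ) : ℝ :=
  c₁⁻¹ * thrF d η (B2.pFn b₀ p η)

/-- For `0 < η ≦ 1`, `d ≧ 2`, `b₀ ≧ 0`, `p ≧ 0`: `η^{−(d−2)/2}p(η) ≧ b₀` (both factors `η^{−(d−2)/2}` and `(1 + log η⁻¹)^p` are `≧ 1`).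
[cite: Balaban1982Higgs1, (3.1) p.613] -/
theorem thrF_pFn_ge {d : ℕ} (hd : 2 ≤ d) {b₀ p η : ℝ} (hη : 0 < η) (hη1 : η ≤ 1) (hb₀ : 0 ≤ b₀) (hp : 0 ≤ p) :
    b₀ ≤ thrF d η (B2.pFn b₀ p η) := by
  unfold thrF B2.pFn
  have hd' : (2 : ℝ) ≤ d := by exact_mod_cast hd
  have h1 : 1 ≤ η ^ (-(((d : ℝ) - 2) / 2)) :=
    Real.one_le_rpow_of_pos_of_le_one_of_nonpos hη hη1 (by linarith)
  have hlog : 0 ≤ Real.log η⁻¹ := Real.log_nonneg ((one_le_inv₀ hη).2 hη1)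
  have h2 : 1 ≤ (1 + Real.log η⁻¹) ^ p := Real.one_le_rpow (by linarith) hp
  calc b₀ = 1 * (b₀ * 1) := by ring
    _ ≤ η ^ (-(((d : ℝ) - 2) / 2)) * (b₀ * (1 + Real.log η⁻¹) ^ p) :=
      mul_le_mul h1 (mul_le_mul_of_nonneg_left h2 hb₀) (by positivity) (zero_le_one.trans h1)

/-- **The printed radius is uniformly bounded below**: with `L^Kε ≦ ε₀ ≦ 1`, `d ≧ 2`, `c₁ > 0`, `b₀ ≧ 0`, `p ≧ 0`,
`r = c₁⁻¹(L^Kε)^{−(d−2)/2}p(L^Kε) ≧ c₁⁻¹b₀` — an ε-independent `r₀` for `Inputs.hr`. [cite: Balaban1982Higgs1, (3.67) p.625] -/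
theorem radius367_ge {d : ℕ} (hd : 2 ≤ d) {c₁ b₀ p ε₀ : ℝ} (hc₁ : 0 < c₁) (hb₀ : 0 ≤ b₀) (hp : 0 ≤ p) (hε₀ : ε₀ ≤ 1) {K : ℕ}
    (hK : P.mesh K ≤ ε₀) : c₁⁻¹ * b₀ ≤ radius367 d c₁ b₀ p (P.mesh K) :=
  mul_le_mul_of_nonneg_left (thrF_pFn_ge hd (P.mesh_pos K) (hK.trans hε₀) hb₀ hp) (inv_pos.2 hc₁).le

end Uniform

/-! ## 2. Constants chosen before the lattice; the displayed inputs on one lattice -/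

/-- The couplings of the renormalized action (1.11) on the lattice `P`: `m₀² = m² + δm²(ε, e, λ)`, `λ`, `μ₀²`, `E = E₀ + E₁` — so that
`B1Sect1Statements.ModelData.zRen P = HiggsLattice.partitionFn P 0 N (e, q) (couplings D P)` (`zRen_eq`).
[cite: Balaban1982Higgs1, (1.10)–(1.13) pp.605–606] -/
noncomputable def couplings (D : ModelData) (P : Params) : Couplings :=
  ⟨D.msq + D.δmsq P.ε D.C.e D.lam, D.lam, D.mu0sq, D.e0 P + D.e1 P⟩

/-- `Z^ε` of the Theorem is the partition function (1.10) at the renormalized couplings (definitional unfolding of r01's `zRen`).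
[cite: Balaban1982Higgs1, (1.10) p.605] -/
theorem zRen_eq (D : ModelData) (P : Params) : D.zRen P = partitionFn P 0 D.N D.C (couplings D P) := rfl

/-- `|T_ε| ≧ 0` ((1.21): `|T_ε| = ε^d·#T_ε`). [cite: Balaban1982Higgs1, (1.21) p.607] -/
theorem volT_nonneg (P : Params) : 0 ≤ volT P :=
  mul_nonneg (pow_nonneg (P.mesh_pos 0).le _) (Nat.cast_nonneg _)

/-- **The constants chosen BEFORE the lattice** (*"independent of ε, T_ε"*, p. 606): the parameter `a > 0` of the renormalization
transformations (1.22); the constant `C ≧ 0` and the exponent `κ₀ > 0` of the step factor `exp(−O(1)(L^kε)^{κ₀}|T_ε|)` of (3.55)/(3.60)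
(p. 622: *"for some independent of k positive constants κ₀, δ₀, and O(1)"*); the final scale `ε₀ > 0` (p. 622: *"L^kε ≦ ε₀ for
sufficiently small ε₀"*; p. 624); `C₁` (the `O(1)|T_ε|` of (3.66), Prop. 3.1), `C₂` (the bound of `|V^{(K),ε}|`, p. 625), `C₅` (*"The
quatratic forms in the exponential above are bounded"*, p. 625), `C₆` (the `O(1)` of (3.69)); a lower bound `r₀ > 0` of the radius of
(3.67) (e.g. `c₁⁻¹b₀`, `radius367_ge`). [cite: Balaban1982Higgs1, Theorem (1.14) p.606; (3.66)–(3.69) pp.624–625] -/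
structure Consts where
  a : ℝ
  Cst : ℝ
  κ₀ : ℝ
  ε₀ : ℝ
  C₁ : ℝ
  C₂ : ℝ
  C₅ : ℝ
  C₆ : ℝ
  r₀ : ℝ
  ha : 0 < a
  hC : 0 ≤ Cst
  hκ₀ : 0 < κ₀
  hε₀ : 0 < ε₀
  hr₀ : 0 < r₀

/-- **`E₋`**, the constant of the lower bound (1.14) for the model: `E₋ = C₁ + C₂ + C·ε₀^{κ₀}/(L^{κ₀} − 1) + C₄(ε₀/L, r₀) + C₅ + C₆` — a
function of the model data `d, N, L` and of the constants only (the per-lattice `E₋(ε)` of `B1Ineq368BoxBound.lowerBound_model` with its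
box constant `C₄(L^Kε, r)` replaced by the uniform `C₄(ε₀/L, r₀)`). [cite: Balaban1982Higgs1, Theorem (1.14) p.606; (3.68)–(3.69) p.625] -/
noncomputable def Consts.eMinus (U : Consts) (D : ModelData) : ℝ :=
  U.C₁ + U.C₂ + U.Cst * (U.ε₀ ^ U.κ₀ / ((D.L : ℝ) ^ U.κ₀ - 1)) + boxConstU D.d D.N (U.ε₀ / D.L) U.r₀ + U.C₅ + U.C₆

/-- **The displayed inputs of Sects. 2–3 on ONE lattice `P`** with the constants `U` — exactly the hypotheses of
`B1Ineq368BoxBound.lowerBound_model` (restrictions (3.27)–(3.28) built with the model's `(e, q)`, `μ₀²`, `m²`): the number `K ≦` the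
`K` of (1.2) of renormalization steps, with the stopping rule `L^Kε ≦ ε₀ < L^{K+1}ε` (p. 624); the thresholds `(ℓ_k, p_k)` of the
restrictions; the effective actions `S^{(k)}` with `S^{(0)} = S^ε` the renormalized action (1.11) and `exp(−S^{(k)}) ∈ L¹` (`k ≦ K`); the
step bound `h360` of the induction (3.26) ((3.38) with (3.51), (3.55), (3.60), pp. 618–623, read back on the `L^{k+1}ε`-lattice) at the
levels `k < K`; the quadratic forms `⟨A,Δ^{(K)}A⟩`, `⟨φ,Δ^{(K)}(0)φ⟩` and the interaction `V^{(K),ε}` of (3.66) with (E1) the expansion of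
Prop. 3.1 on the support of `χ_K` (constant `C₁`), (E2) `|V^{(K),ε}| ≦ C₂|T_ε|` (Prop. 3.2, p. 625), (E3) `χ_K = 1` on the small-field
set of (3.67) of radius `r ≧ r₀` (regularity of the background fields, Props. 2.2–2.3), `0 ≦ ½(forms) ≦ C₅|T_ε|` there, and the (3.69)
conjunct `Z_KZ_K(0)e^{−E₀} ≧ e^{−C₆|T_ε|}`. [cite: Balaban1982Higgs1, (3.26) p.617; (3.60) p.623; (3.66)–(3.69) pp.624–625] -/
structure Inputs (D : ModelData) (U : Consts) (P : Params) where
  K : ℕ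
  hKP : K ≤ P.K
  hKε : P.mesh K ≤ U.ε₀
  hstop : U.ε₀ < P.mesh (K + 1)
  ℓ : ℕ → ℝ
  p : ℕ → ℝ
  S : (k : ℕ) → VecField P k → ScalarField P k D.N → ℝ
  h0 : S 0 = action D.C (couplings D P)
  hS : ∀ k, k ≤ K → Integrable fun Φ : VecField P k × ScalarField P k D.N => Real.exp (-S k Φ.1 Φ.2)
  h360 : ∀ k, k < K → ∀ (B : VecField P (k + 1)) (ψ : ScalarField P (k + 1) D.N),
    chiW D.C ℓ p D.mu0sq D.msq U.a (k + 1) B ψ ≠ 0 →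
      Real.exp (-S (k + 1) B ψ) * Real.exp (-(U.Cst * P.mesh k ^ U.κ₀ * P.vol 0 Finset.univ))
        ≤ doubleRTk D.C U.a (extW D.mu0sq U.a k) (fun A φ => chiW D.C ℓ p D.mu0sq D.msq U.a k A φ * Real.exp (-S k A φ)) B ψ
  qA : VecField P K × ScalarField P K D.N → ℝ
  qφ0 : VecField P K × ScalarField P K D.N → ℝ
  V : VecField P K × ScalarField P K D.N → ℝ
  hqAm : Measurable qA
  hqφm : Measurable qφ0
  ZK : ℝ
  ZK0 : ℝ
  E₀ : ℝ
  r : ℝ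
  hZK : 0 ≤ ZK
  hZK0 : 0 ≤ ZK0
  hr : U.r₀ ≤ r
  hE1 : ∀ ω : VecField P K × ScalarField P K D.N, chiW D.C ℓ p D.mu0sq D.msq U.a K ω.1 ω.2 ≠ 0 →
    ZK * ZK0 * Real.exp (-(qA ω) / 2 - qφ0 ω / 2 + V ω - E₀ - U.C₁ * P.vol 0 Finset.univ) ≤ Real.exp (-S K ω.1 ω.2)
  hE2 : ∀ ω : VecField P K × ScalarField P K D.N, chiW D.C ℓ p D.mu0sq D.msq U.a K ω.1 ω.2 ≠ 0 →
    |V ω| ≤ U.C₂ * P.vol 0 Finset.univ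
  hE3 : ∀ ω ∈ smallSet P D.N K r, chiW D.C ℓ p D.mu0sq D.msq U.a K ω.1 ω.2 = 1
  hQ : ∀ ω ∈ smallSet P D.N K r, 0 ≤ qA ω / 2 + qφ0 ω / 2 ∧ qA ω / 2 + qφ0 ω / 2 ≤ U.C₅ * P.vol 0 Finset.univ
  h369 : Real.exp (-U.C₆ * P.vol 0 Finset.univ) ≤ ZK * ZK0 * Real.exp (-E₀)

/-! ## 3. The lower bound of (1.14) for the concrete cutoff family -/

/-- **Per lattice, uniform constant**: on an admissible lattice (`d, L, M` of the model) with *"m² > 0"* and `L > 1`, the inputs give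
`exp(−E₋|T_ε|) ≦ Z^ε` with the ε-INDEPENDENT `E₋ = U.eMinus D` — `B1Ineq368BoxBound.lowerBound_model`, then `C₄(L^Kε, r) ≦ C₄(ε₀/L, r₀)`
(`boxConst_le_of_stop`) and `|T_ε| ≧ 0`. [cite: Balaban1982Higgs1, Theorem (1.14) p.606; (3.68)–(3.69) p.625; p.624 (before (3.66))] -/
theorem lowerBound_lattice (D : ModelData) (hm : 0 < D.msq) (hL : 1 < D.L) (U : Consts) {P : Params} (hP : D.Admissible P)
    (I : Inputs D U P) : Real.exp (-(U.eMinus D * volT P)) ≤ D.zRen P := by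
  obtain ⟨hd, hPL, -⟩ := hP
  have hPL' : (P.L : ℝ) = D.L := by exact_mod_cast hPL
  have hL' : 1 < (P.L : ℝ) := by
    rw [hPL']
    exact_mod_cast hL
  have h := lowerBound_model D.C I.ℓ I.p D.mu0sq U.ha hm hL' I.hKP (couplings D P) I.S I.h0 I.hS U.hC U.hκ₀ I.hKε I.h360
    I.hqAm I.hqφm I.hZK I.hZK0 (U.hr₀.trans_le I.hr) I.hE1 I.hE2 I.hE3 I.hQ I.h369
  have hbox : boxConst P D.N I.K I.r ≤ boxConstU D.d D.N (U.ε₀ / D.L) U.r₀ := by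
    have hb := boxConst_le_of_stop (N := D.N) hd U.hε₀ I.hstop U.hr₀ I.hr
    rwa [hPL'] at hb
  have hE : (U.C₁ + U.C₂ + U.Cst * (U.ε₀ ^ U.κ₀ / ((P.L : ℝ) ^ U.κ₀ - 1)) + boxConst P D.N I.K I.r + U.C₅) + U.C₆
      ≤ U.eMinus D := by
    rw [hPL']
    unfold Consts.eMinus
    linarith
  rw [zRen_eq]
  refine le_trans ?_ h
  rw [neg_mul, Real.exp_le_exp]
  exact neg_le_neg (mul_le_mul_of_nonneg_right hE (volT_nonneg P))

/-- **Theorem (1.14), lower half, FOR THE MODEL FAMILY**: if every admissible lattice carries the inputs of Sects. 2–3 with the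
constants `U` chosen before the lattice, then `exp(−E₋|T_ε|) ≦ Z^ε` on the whole concrete cutoff family with the ONE constant
`E₋ = U.eMinus D` — r14's `B1LowerBound.LowerBoundWith` at r01's `ModelData.cutoffFamily`. [cite: Balaban1982Higgs1, Theorem (1.14) p.606; (3.68)–(3.69) p.625] -/
theorem lowerBoundWith_cutoffFamily (D : ModelData) (hm : 0 < D.msq) (hL : 1 < D.L) (U : Consts)
    (h : ∀ P : Params, D.Admissible P → Nonempty (Inputs D U P)) :
    B1LowerBound.LowerBoundWith D.cutoffFamily (U.eMinus D) := by
  intro i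
  obtain ⟨I⟩ := h i.1 i.2
  exact lowerBound_lattice D hm hL U i.2 I

/-- *"there exist the constant E₋ independent of ε, T_ε"* with `exp(−E₋|T_ε|) ≦ Z^ε`: r14's `B1LowerBound.LowerBoundPrinted` at the
concrete family, from the inputs. [cite: Balaban1982Higgs1, Theorem (1.14) p.606] -/
theorem lowerBoundPrinted_cutoffFamily (D : ModelData) (hm : 0 < D.msq) (hL : 1 < D.L) (U : Consts)
    (h : ∀ P : Params, D.Admissible P → Nonempty (Inputs D U P)) : B1LowerBound.LowerBoundPrinted D.cutoffFamily :=
  ⟨U.eMinus D, lowerBoundWith_cutoffFamily D hm hL U h⟩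

/-- r01's `LowerBound114 D` — the lower half of the concrete Theorem `Thm114` (its standing hypothesis *"m² > 0"* feeds the
restrictions) — from the inputs with constants chosen before the lattice. [cite: Balaban1982Higgs1, Theorem (1.14) p.606; (3.68)–(3.69) p.625] -/
theorem lowerBound114_of_inputs (D : ModelData) (hL : 1 < D.L) (U : Consts)
    (h : ∀ P : Params, D.Admissible P → Nonempty (Inputs D U P)) : LowerBound114 D :=
  fun _ _ hm _ _ => lowerBoundPrinted_cutoffFamily D hm hL U h

/-- DICTIONARY: unfolded (r01's `lowerBoundPrinted_cutoffFamily_iff` made explicit with the constant), the conclusion reads verbatim as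
the lower bound of (1.14) on every admissible lattice: `exp(−E₋|T_ε|) ≦ Z^ε`, `E₋ = U.eMinus D` fixed before `ε, T_ε`.
[cite: Balaban1982Higgs1, Theorem (1.14) p.606] -/
theorem lowerBound_explicit (D : ModelData) (hm : 0 < D.msq) (hL : 1 < D.L) (U : Consts)
    (h : ∀ P : Params, D.Admissible P → Nonempty (Inputs D U P)) :
    ∀ P : Params, D.Admissible P → Real.exp (-(U.eMinus D * volT P)) ≤ D.zRen P :=
  fun P hP => (h P hP).elim (lowerBound_lattice D hm hL U hP)

end Literature.MathematicalPhysics.QuantumFieldTheory.Balaban1983to89.B1LowerBound114Model
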